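import Literature.NumberTheory.EllipticCurves.PAdicOneVariableEquivarianceOfComparison
import Literature.NumberTheory.EllipticCurves.PadicTwoSupportOfColemanTrace
import HarnessLib

/-!
# `F = ℚ₂`: the U_0-equivariance input `ν₂♭(v̄ b) = ν₁♭(b)` of the measure-side recipe, with
# `Θ = θ ∘ (𝒪̂_{ℚ₂^nr} → 𝒪_{ℂ_F})` read in Mathlib's `ℂ_[2]` and `e : 𝒪[ℚ_[2]] → ℤ_[2]` the identity

Topic `NumberTheory/EllipticCurves`; namespace `Literature.NumberTheory.EllipticCurves.PadicTwo`.

Specialisation of `PAdicOneVariableEquivarianceOfComparison.lean` (de Shalit 1987, I.3.4 Lemma (ii):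
`μ_{σβ}(σU) = μ_β(U)`) to `F = ℚ_[2]`, `𝕜 = ℂ_[2]`,
`Θ := θ ∘ subtype ∘ (𝒪̂ → 𝒪_{ℂ_F})` with `θ = CompletedAlgClosure.equivPadicComplex 2`, and ANY ring map
`e : 𝒪[ℚ_[2]] → ℤ_[2]` which is the identity on `ℚ_[2]` (the tree's `Padic.nonempty_valuationInteger_ringEquiv_padicInt`
is such an `e`; it is kept as a hypothesis-object `(e, he)` because the tree states it as `Nonempty`):

* `theta_intToUnrCoeff_eq_padicIntCast` — the compatibility `Θ ∘ ι = padicIntCast ∘ e` on `𝒪[ℚ_[2]]`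
  (`coe_algebraMap_intToUnrCoeff`, `equivPadicComplex_algebraMap`);
* ★★★ `restrictUnits_density_unitInv_μ_unitMul_of_eq_C_mul_subst_homC'` — for `h₂ = a · (h₁ ∘ [a]_{f'})` in
  `𝒪̂⟦X⟧` and `v = e a ∈ ℤ_2^×`: **`ν₂♭(v̄ b) = ν₁♭(b)`** for `ν_i♭ = restrictUnits (x⁻¹ · D_{Θ(h_i ∘ ϑ)})` — the
  `hν` of `GroupDistribution.comap_family_equivariant(_of_character)` at `F = ℚ₂`.

Everything is proved; no named facts, no definitions, no instances, no `sorry`.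

## References

* [deShalit1987] E. de Shalit, *Iwasawa theory of elliptic curves with complex multiplication* (1987),
  I.3.4 Lemma (ii) (p. 18), II.4.6 (14) (p. 59).
-/

noncomputable section

open MvPowerSeries

namespace Literature.NumberTheory.EllipticCurves

namespace PadicTwo

open ValuativeRel IsLocalRing Field
open Literature.NumberTheory.GaloisRepresentations Literature.NumberTheory.GaloisRepresentations.IsNonarchimedeanLocalField
  Literature.NumberTheory.GaloisRepresentations.LubinTate Literature.NumberTheory.PAdicHodge

attribute [local instance] ltNormUniformSpace ltNormIsUniformAddGroup rk1 nF nE fintypeResidueField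

/-- **`Θ ∘ ι = padicIntCast ∘ e` on `𝒪[ℚ_[2]]`** for `Θ = θ ∘ (𝒪̂ → 𝒪_{ℂ_F} ⊆ ℂ_F)` and any `e` which is the
identity on `ℚ_[2]`. [cite: deShalit1987, I.3.4 (p. 18)] -/
theorem theta_intToUnrCoeff_eq_padicIntCast :
    haveI := Padic.isNonarchimedeanLocalField_holds 2
    ∀ (e : 𝒪[ℚ_[2]] →+* ℤ_[2]) (_he : ∀ a : 𝒪[ℚ_[2]], ((e a : ℤ_[2]) : ℚ_[2]) = (a : ℚ_[2])) (a : 𝒪[ℚ_[2]]),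
      (((CompletedAlgClosure.equivPadicComplex 2).toRingHom.comp (CBall ℚ_[2]).subtype).comp
          (algebraMap (UnrCoeff ℚ_[2]) (CBall ℚ_[2]))) (intToUnrCoeff ℚ_[2] a) =
        padicIntCast ℂ_[2] (e a) := by
  haveI := Padic.isNonarchimedeanLocalField_holds 2
  intro e he a
  rw [RingHom.comp_apply, RingHom.comp_apply, Subring.subtype_apply, coe_algebraMap_intToUnrCoeff,
    RingEquiv.toRingHom_eq_coe, RingHom.coe_coe, CompletedAlgClosure.equivPadicComplex_algebraMap,
    padicIntCast_apply, he]
  rfl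

/-- ★★★ **`F = ℚ₂`: `ν₂♭(v̄ b) = ν₁♭(b)` on the unit cells** when `h₂ = a · (h₁ ∘ [a]_{f'})` in `𝒪̂_{ℚ₂^nr}⟦X⟧`,
`v = e a ∈ ℤ_2^×`, `ν_i♭ = restrictUnits (x⁻¹ · D_{Θ(h_i ∘ ϑ)})` read in `ℂ_[2]` — the U_0-equivariance input of
the pull-back `comap` (de Shalit's `μ_{σβ}(σU) = μ_β(U)`). [cite: deShalit1987, I.3.4 Lemma (ii) (p. 18), II.4.6 (14) (p. 59)] -/
theorem restrictUnits_density_unitInv_μ_unitMul_of_eq_C_mul_subst_homC' :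
    haveI := Padic.isNonarchimedeanLocalField_holds 2
    ∀ {σ₀ : absoluteGaloisGroup ℚ_[2]} (hσ₀ : IsAbsArithFrob σ₀) (u : 𝒪[ℚ_[2]]ˣ)
      {ε : (maxUnramifiedCompletion ℚ_[2])ˣ}
      (hε : maxUnramifiedCompletion.galAut ℚ_[2] σ₀ (ε : maxUnramifiedCompletion ℚ_[2]) =
        algebraMap 𝒪[ℚ_[2]] (maxUnramifiedCompletion ℚ_[2]) (u : 𝒪[ℚ_[2]]) * (ε : maxUnramifiedCompletion ℚ_[2]))
      (e : 𝒪[ℚ_[2]] →+* ℤ_[2]) (_he : ∀ a : 𝒪[ℚ_[2]], ((e a : ℤ_[2]) : ℚ_[2]) = (a : ℚ_[2]))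
      (a : 𝒪[ℚ_[2]]) (v : ℤ_[2]ˣ) (_hv : (v : ℤ_[2]) = e a) (h₁ h₂ : PowerSeries (UnrCoeff ℚ_[2]))
      (_hh : h₂ = PowerSeries.C (intToUnrCoeff ℚ_[2] a) *
        PowerSeries.subst (homC' (Padic.isUniformizer_natCast 2) u a) h₁) {C : ℝ}
      (hC₁ : ∀ k, ‖PowerSeries.coeff k ((PowerSeries.subst (compSeriesC (Padic.isUniformizer_natCast 2) hσ₀ u hε)
        h₁).map (((CompletedAlgClosure.equivPadicComplex 2).toRingHom.comp (CBall ℚ_[2]).subtype).comp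
          (algebraMap (UnrCoeff ℚ_[2]) (CBall ℚ_[2]))))‖ ≤ C)
      (hC₂ : ∀ k, ‖PowerSeries.coeff k ((PowerSeries.subst (compSeriesC (Padic.isUniformizer_natCast 2) hσ₀ u hε)
        h₂).map (((CompletedAlgClosure.equivPadicComplex 2).toRingHom.comp (CBall ℚ_[2]).subtype).comp
          (algebraMap (UnrCoeff ℚ_[2]) (CBall ℚ_[2]))))‖ ≤ C)
      (n : ℕ) (b : ZMod (2 ^ (n + 1))),
      (restrictUnits ((invAmice₁ 2 ((PowerSeries.subst (compSeriesC (Padic.isUniformizer_natCast 2) hσ₀ u hε)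
          h₂).map (((CompletedAlgClosure.equivPadicComplex 2).toRingHom.comp (CBall ℚ_[2]).subtype).comp
            (algebraMap (UnrCoeff ℚ_[2]) (CBall ℚ_[2])))) hC₂).density
          (ProfiniteTower.padicInt_isUniform 2) (unitInv ℂ_[2]) uniformContinuous_unitInv norm_unitInv_le)).μ n
          (BoundedDistribution.unitMul (BoundedDistribution.unitMod (n + 1) v) b) =
        (restrictUnits ((invAmice₁ 2 ((PowerSeries.subst (compSeriesC (Padic.isUniformizer_natCast 2) hσ₀ u hε)
          h₁).map (((CompletedAlgClosure.equivPadicComplex 2).toRingHom.comp (CBall ℚ_[2]).subtype).comp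
            (algebraMap (UnrCoeff ℚ_[2]) (CBall ℚ_[2])))) hC₁).density
          (ProfiniteTower.padicInt_isUniform 2) (unitInv ℂ_[2]) uniformContinuous_unitInv norm_unitInv_le)).μ n b := by
  haveI := Padic.isNonarchimedeanLocalField_holds 2
  intro σ₀ hσ₀ u ε hε e he a v hv h₁ h₂ hh C hC₁ hC₂ n b
  exact Literature.NumberTheory.EllipticCurves.restrictUnits_density_unitInv_μ_unitMul_of_eq_C_mul_subst_homC'
    (Padic.residueFieldCard_eq 2) (Padic.isUniformizer_natCast 2) hσ₀ u hε _ e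
    (theta_intToUnrCoeff_eq_padicIntCast e he) a v hv h₁ h₂ hh hC₁ hC₂ n b

end PadicTwo

end Literature.NumberTheory.EllipticCurves

end
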